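import Literature.NumberTheory.Rogawski1990.CohomologicalFinComponentIsTheta
import Literature.NumberTheory.Automorphic.UnitaryGroupPlaceInclusion
import Literature.NumberTheory.Automorphic.Liu2021.Def411WeilCarriersLocalIsotypyAtPlace
import Literature.NumberTheory.Automorphic.Liu2021.Def411WeilCarriersLocalTypesOfEquiv
import Literature.NumberTheory.Automorphic.UnitaryGroupLocalCongr
import Literature.RepresentationTheory.Liu2021.GlobalOscillatorIsomorphismCriterion
import Literature.NumberTheory.GelbartRogawski1991.FiniteAdelicWeilCentralCoinvariantsIsotypic
import Summits.HodgeConjecture.CorCM.B01.Transposition.Item6OmegaChiSplitting   -- `OmegaChiSplitting.chiLocalSplittingsD` (★ B01; not on the R2 cone list)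
import Summits.HodgeConjecture.HodgeConjecture.Theorems.F0P2cStubCEOfLocalThetaTypes        -- ★ p805164 F0P2-p01 (g3): `stubCE_of_localThetaTypes : CE_R → CE` (stub CER fold)
import Summits.HodgeConjecture.HodgeConjecture.Theorems.F0P2eStubGLGlobalLine        -- ★ p808695 F0P2-p03 (g3): `stubGL_holds` (stub GL fold)
import Summits.HodgeConjecture.HodgeConjecture.Theorems.F0P2eStubLWLocalWitness        -- ★ p808696 F0P2-p03 (g3): `stubLW_holds` (stub LW fold)
import Summits.HodgeConjecture.HodgeConjecture.Theorems.F0P2eStubLRLocalReindex        -- ★ p808692 F0P2-p04 (g3): `stubLR_holds` (stub LR fold)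
import Summits.HodgeConjecture.HodgeConjecture.Theorems.F0P2eStubLTLocalTypeTransport        -- ★ p808809 F0P2-p02 (g2): `stubLT_prodUnique_holds` (stub LTpu fold)
import HarnessLib

/-!
# F0_P2CELocalToGlobal — the RUNG-2 road for the engine letter CE of the (C)-line (HCML floor 0, programme P2 · theta ∕ `hdictE`)

LINE skeleton (LINES-FIRST, D-0183 floor 0) for crux `H413` = `stmt-HodgeConjecture-24833` of route `HCCMUnconditional`, programme P2
(`hdictE : oscillatorTriple_dictionaryExistence`; P2 socket item `F0HdictE` = `stmt-HodgeConjecture-27455`, director s426 R2).  Planner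
F0P2-plan (g4), 2026-08-31.  A SUB-LINE of the registered (C)-line `Lines/F0_P2CohFinComponentIsThetaC.lean` (F0P2-plan g3, v1.2+;
skeleton of record for the crux stays `Lines/a3_liu413.lean`): it derives that line's registered engine letter
`F0P2CohFinComponentIsThetaC.StubCELocalTypesTheta` (CE) from FOUR smaller registered stubs and one fold.
SHAPE (deliberate, F0P2-ref1 r50 (b)(5) = O50-1): this file does NOT import the (C)-line — it restates CE VERBATIM as `CETarget` (§0; statement text =
tree v1.2R :217–251, `IsLocalTypeAt` = :97–103, `diff` = the decl name only), and `CETarget` ↔ `F0P2CohFinComponentIsThetaC.StubCELocalTypesTheta` is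
`Iff.rfl` (δ; certified in the planner's joint scratch `cert-CE-subline-v1.lean`, rc 0, with `cert_fold_token : StubCELocalTypesTheta :=
F0P2CELocalToGlobal.stubCE_of_rung2_stubs`).  Hence the (C)-line may later fold its `stub_CE_localTypesTheta` EITHER by importing this file (no cycle) OR —
preferred, Lines-free — over Theorems-level closers only (F0P2-p01 (g3) O50-1 twin `Theorems/F0P2eCEOfRung2.lean :: stubCE_of_PK_GL_LW_LT` applied to the ★
closers of PK∕GL∕LW∕LT); an edition «by name» (importing the (C)-line) is NOT planned, precisely to keep that fold acyclic.  Imports: Literature ★ + ★ B01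
`Item6OmegaChiSplitting` + ★ p805164 `Theorems.F0P2cStubCEOfLocalThetaTypes` (the CER fold) + the ★ closers of GL∕LW∕LR∕LTpu (v1.1 folds) — no `Lines` module.

HONEST LABEL: HC_CM is proved only modulo the printed citations until rung 0 closes.  This file moves NO citation into the kernel by itself: it
re-cuts the engine letter CE so that everything in it that is NOT the trace-formula classification is proved in-house on this floor.

## Thesis of the sub-line (why re-cut CE)

After the (C)-line's v1.3∕v1.4 folds (CD, CL, CI, CF, CU ★; CE_R∕CE-L GREEN) the live `sorry`s of programme P2 are exactly the two ENGINE letters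
{CE, E3}.  CE as registered («the local types of `σ` are those of the GLOBAL Weil carrier `ρ^{U(V)⊠χ_W}(μ, a, χ)` at ONE global line `a`») still
bundles three things that are NOT Rogawski's classification and that the tree can prove: (i) the passage from `rhoAtLine` to Liu's local theta types
`X_v` (★∕GREEN CE-L, F0P2-p01 g3 — folded into the node `CoreCER` below), (ii) the HASSE step «a cofinite family of local norm classes
`(ε_v)_v` IS the family of classes of ONE global line `a`» [Omeara1963 §71 Thm 71:19; Liu2021 Def 4.12: admissibility of `ε`], and (iii) the LOCAL
class transport «`X_v(μ, b, χ)` depends only on the class of `b` in `L⁺_vˣ ⧸ N L_vˣ`» [Liu2021 Lem D.1 (3); MVW87 Chap. 3].  The road below strips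
(ii)+(iii) out of the letter:

    PK (engine, place-by-place classes)  +  GL (Hasse for norm classes, S)  +  LW (local norm witness, S)
      +  LT (local type transport, M)  where  LT := LTpu ∘ LR ∘ LR  (LR local re-enumeration, S∕M; LTpu transport at `prodUnique`, M)   [`lt_of_LR_LTpu`]
      ⟹ `CoreCER` (= F0P2-p01's CE_R: ONE global line)                                   [`coreCER_of_PK_GL_LW_LT`, kernel-checked here]
      ⟹ CE (registered letter)  via CER (= ★ p805164 `F0P2cStubCEOfLocalThetaTypes.stubCE_of_localThetaTypes`, FOLDED BY NAME)   [`stubCE_of_rung2`]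

and `stubPK_of_coreCER` records the converse bookkeeping PK ⇐ CE_R (so PK ⟺ CE over the tree: the letter is re-cut, not strengthened — debt class U
unchanged, census count 1 → 1, F0P2-ref1 r50 (b)(2)).  What is LEFT for the engine after this road is the pure local-packet statement PK: «`σ_v ∈ Π(ξ_v) =
{X_v(μ, a⁺_v, χ), X_v(μ, a⁻_v, χ)}` at every finite `v`, non-split member at almost all `v`» — Rogawski1990 Thm 13.3.6 (c) + 13.1.1 read through the
GR91∕HKS96 local theta dictionary; its rung-3 producers are programme P3's S-layer (local packet membership, currency `IrrClass ((cmDatum L 3 H).Local v)`,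
seam ★ `localPiEquiv`) and a local dictionary row DICT_v (named in the card `Lines/F0_P2CELocalToGlobal.md`, not stubs of this file).

## Registered stubs (6: PK open; GL, LW, LR, LTpu, CER ★ folded — edition v1.1) and heads

| stub | decl | class | size | hand ∕ folds over |
|---|---|---|---|---|
| PK   | `StubPKLocalThetaClasses` | ENGINE letter (U) | — | P3 S-layer ∘ DICT_v (rung 3) |
| GL   | `StubGLGlobalLine`        | in-house S | 1 file | F0P2-p03 (g3) `Theorems/F0P2eStubGLGlobalLine.lean :: stubGL_holds` (★ p808695) over ★ `exists_prescribed_normClass_of_finite` |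
| LW   | `StubLWLocalWitness`      | in-house S | 1 file | F0P2-p03 (g3) `Theorems/F0P2eStubLWLocalWitness.lean :: stubLW_holds` (★ p808696) over ★ `exists_localRing_units_mul_conjLocal_eq` |
| LR   | `StubLRLocalReindex`      | in-house S∕M | 1 file | F0P2-p04 (g3) `Theorems/F0P2eStubLRLocalReindex.lean :: stubLR_holds` (★ p808692) over ★ `exists_omegaAtLine_equiv_rhoVAtLine_reindex` + ★ `isotypicComponent_rhoAtLine_comp_eq_top_of_factors` |
| LTpu | `StubLTProdUnique`        | in-house M | 1 file | F0P2-p02 (g2) `Theorems/F0P2eStubLTLocalTypeTransport.lean :: stubLT_prodUnique_holds` (★ p808809) over ★ `lineTransportOp_omegaLoc_localLineInl'`, ★ S6a, ★ `ker_localCenter_eq_of_line`, ★ `TwistedCoinv.mapEquiv` |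
| CER  | `StubCERCoreToCE`         | fold ★ | 0 | ★ p805164 F0P2-p01 (g3) `F0P2cStubCEOfLocalThetaTypes.stubCE_of_localThetaTypes` (folded by name in THIS edition) |

Derived node LT = `StubLTLocalTypeTransport` (general `e₁`): `stub_LT_localTypeTransport := lt_of_LR_LTpu stub_LR_localReindex stub_LTpu_prodUnique`.
Heads (sorry-free): `lt_of_LR_LTpu`, `stub_LT_localTypeTransport`, `coreCER_of_PK_GL_LW_LT`, `stubCE_of_rung2`, `stubCE_of_rung2_stubs` (THE ONE concluder of
`CETarget`), `stubPK_of_coreCER`.  Closers restate the stub body VERBATIM from THIS file (never import `Lines`), land `--supports stmt-HodgeConjecture-24833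
--as helper`, and each open stub then folds by ONE token `theorem stub_<X> : Stub<X> := <Module>.<closer>` in the next edition of this file.

## References

* [Rogawski1990] J. Rogawski, *Automorphic Representations of Unitary Groups in Three Variables*, Ann. Math. Stud. 123 (1990): Thm 13.3.6 (c), Thm 13.1.1, §12.2–12.3, §13.3.
* [GelbartRogawski1991] S. Gelbart, J. Rogawski, Invent. Math. 105 (1991) 445–472: Thm 5.1.1, Lem 5.1.2, §3.1.
* [HarrisKudlaSweet1996] M. Harris, S. Kudla, W. Sweet, J. AMS 9 (1996): Thm 6.1 (local theta dichotomy for U(1) × U(3)-type pairs).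
* [Liu2021] Y. Liu, Camb. J. Math. 9 (2021) = arXiv:2102.11518: Def 4.11–4.12, Rem 4.14, Thm 4.18 (2), App. D §D.1, Lem D.1 (1)(3).
* [MoeglinVignerasWaldspurger1987] C. Mœglin, M.-F. Vignéras, J.-L. Waldspurger, LNM 1291 (1987): Chap. 2 II.1, Chap. 3 I.1–I.3, IV.4.
* [Kudla1994] S. Kudla, Israel J. Math. 87 (1994): §3 Thm 3.1 (splittings and their dependence on the character data).
* [Omeara1963] O. T. O'Meara, *Introduction to Quadratic Forms* (1963): §63, §65 Prop 65:21, §71 Thm 71:19, Cor 71:19a.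
* [Flath1979] D. Flath, PSPM 33.1 (1979): Thm 3.  [Bump1997] D. Bump, *Automorphic Forms and Representations* (1997): §3.4 Prop 3.4.1.
-/

set_option autoImplicit false

-- the mandated namespace has the single-problem summit's repeated segment (`HodgeConjecture.HodgeConjecture`)
set_option linter.dupNamespace false

noncomputable section

open NumberField MeasureTheory IsDedekindDomain
open scoped Matrix ComplexOrder

namespace Summit.HodgeConjecture.HodgeConjecture.Cruxes.H413.F0P2CELocalToGlobal

open Literature.NumberTheory Literature.NumberTheory.Automorphic Literature.NumberTheory.Automorphic.UnitaryGroup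
open Literature.NumberTheory.Automorphic.UnitaryGroup.CotangentForms
open Literature.NumberTheory.Automorphic.IdeleClassGroup
open Literature.NumberTheory.Automorphic.Liu2021 Literature.NumberTheory.Automorphic.Liu2021.Def411WeilCarriers
open Literature.NumberTheory.Automorphic.Liu2021.Def411WeilCarriersDoubling
open Literature.NumberTheory.GelbartRogawski1991 Literature.NumberTheory.GelbartRogawski1991.UnitaryDualPair
open Literature.NumberTheory.GelbartRogawski1991.UnitaryDualPair.WeilCoinv
open Literature.RepresentationTheory Literature.RepresentationTheory.Liu2021
open Literature.NumberTheory.Rogawski1990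
open Summit.HodgeConjecture.CorCM.Transposition

/-! ## §0 The registered CE restated VERBATIM (no `Lines` import — O50-1) -/

/-- `IsLocalTypeAt` VERBATIM from the tree (C)-line v1.2R :97–103 (restated, not imported: the (C)-line must stay importable FROM here — O50-1). -/
def IsLocalTypeAt (F E : Type) [Field F] [NumberField F] [Field E] [NumberField E] [Algebra F E] (c : E ≃ₐ[F] E) (N : ℕ)
    (J : Matrix (Fin N) (Fin N) E) {W : Type} [AddCommGroup W] [Module ℂ W] (ρ : Representation ℂ (finAdelic F E c N J) W)
    (v : HeightOneSpectrum (𝓞 F)) {T : Type} [AddCommGroup T] [Module ℂ T] (τ : Representation ℂ (localPi E c N J v) T) : Prop :=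
  τ.IsIrreducible ∧
    isotypicComponent (MonoidAlgebra ℂ (localPi E c N J v)) (Representation.asModule (ρ.comp (inclPlace F E c N J v)))
      (Representation.asModule τ) = ⊤

/-- (edition v1, by paste) the REGISTERED engine letter CE = `F0P2CohFinComponentIsThetaC.StubCELocalTypesTheta` VERBATIM (tree v1.2R :217–251;
δ-definitionally equal to it: `CETarget ↔ StubCELocalTypesTheta := Iff.rfl`). [cite: Rogawski1990, Thm 13.3.6 (c)] -/
def CETarget : Prop :=
  ∀ (L : Type) [Field L] [NumberField L] [IsCMField L] (ι : L →+* ℂ) (H : Matrix (Fin 3) (Fin 3) L) (T : GL (Fin 3) ℂ)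
    (hT : (T : Matrix (Fin 3) (Fin 3) ℂ)ᴴ * H.map ι * (T : Matrix (Fin 3) (Fin 3) ℂ) = Literature.Geometry.ComplexHyperbolic.BallModel.J),
    (∀ τ' : L →+* ℂ, InfinitePlace.mk τ' ≠ InfinitePlace.mk ι → (H.map τ').PosDef) → 2 ≤ Module.finrank ℚ ↥(maximalRealSubfield L) →
    ∀ {n' : ℕ} (e₁ : Fin 3 × Fin 1 ≃ Fin n') (dV : Fin 3 → L) (hdV : ∀ i, IsCMField.complexConj L (dV i) = dV i)
      (hdV0 : ∀ i, dV i ≠ 0) (g : GL (Fin 3) L),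
      ((g : Matrix (Fin 3) (Fin 3) L).map (cmConjRingHom L))ᵀ * H * (g : Matrix (Fin 3) (Fin 3) L) = Matrix.diagonal dV →
      ∀ (ιV : finAdelic (↥(maximalRealSubfield L)) L (IsCMField.complexConj L) 3 H →*
          finAdelic (↥(maximalRealSubfield L)) L (IsCMField.complexConj L) 3 (Matrix.diagonal dV)),
        (∀ k, ((ιV k : finAdelic (↥(maximalRealSubfield L)) L (IsCMField.complexConj L) 3 (Matrix.diagonal dV)) :
            GL (Fin 3) (FiniteAdeleRing (𝓞 L) L)) =
          (toFinAdeleGL L 3 g)⁻¹ * (k : GL (Fin 3) (FiniteAdeleRing (𝓞 L) L)) * toFinAdeleGL L 3 g) →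
        ∀ (μ : Measure (adelicGroupData (↥(maximalRealSubfield L)) L (IsCMField.complexConj L) 3 H).automorphicQuotient)
          [(adelicGroupData (↥(maximalRealSubfield L)) L (IsCMField.complexConj L) 3 H).IsAutomorphicMeasure μ]
          (W : Type) [AddCommGroup W] [Module ℂ W]
          (σ : Representation ℂ (finAdelic (↥(maximalRealSubfield L)) L (IsCMField.complexConj L) 3 H) W),
          σ.IsIrreducible → σ.IsSmooth → σ.IsAdmissible →
          ∀ P : DiscreteAutomorphicRep (adelicGroupData (↥(maximalRealSubfield L)) L (IsCMField.complexConj L) 3 H) μ,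
            (P.IsHolCotangentAt (cmArchSection L ι H T hT) (cmCompactFactor L ι H T hT) ∨
              P.IsAntiholCotangentAt (cmArchSection L ι H T hT) (cmCompactFactor L ι H T hT)) →
            P.HasFinComponent σ →
            ∃ (μ : Literature.NumberTheory.Automorphic.IdeleClassGroup L →ₜ* Circle) (hμ : IsConjugateSymplectic L μ), HasWeight L μ 1 ∧
              ∃ (a : (↥(maximalRealSubfield L))ˣ) (χ : Chi (↥(maximalRealSubfield L)) L (IsCMField.complexConj L)),
                ∀ (v : HeightOneSpectrum (𝓞 ↥(maximalRealSubfield L))) (Tv : Type) [AddCommGroup Tv] [Module ℂ Tv]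
                  (τ : Representation ℂ (localPi L (IsCMField.complexConj L) 3 H v) Tv),
                  IsLocalTypeAt (↥(maximalRealSubfield L)) L (IsCMField.complexConj L) 3 H σ v τ →
                    IsLocalTypeAt (↥(maximalRealSubfield L)) L (IsCMField.complexConj L) 3 H
                      (rhoAtLine (↥(maximalRealSubfield L)) L (IsCMField.complexConj L) 3 e₁ (Matrix.diagonal dV)
                        (complexConj_imagUnit L) (imagUnit_ne_zero L) (imagUnit_mul_self L) (realDiagonal_isSymm L dV hdV)
                        (isUnit_det_realDiagonal L dV hdV hdV0) (realDiagonal_map L dV hdV).symm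
                        (fun a => isCompatible_chiSplittingLine L e₁ dV hdV hdV0 (toHeckeCharacter L μ)
                          (isUnitary_toHeckeCharacter L μ) ((isOscillatorChar_toHeckeCharacter_iff μ).mpr hμ)
                          (TW (↥(maximalRealSubfield L)) a) (isSymm_TW (↥(maximalRealSubfield L)) a)
                          (isUnit_det_TW (↥(maximalRealSubfield L)) a) (JW (↥(maximalRealSubfield L)) L a)
                          (JW_eq (↥(maximalRealSubfield L)) L a)) ιV a χ) v τ

/-! ## §1 The intermediate node CE_R (F0P2-p01 (g3)): the local components of `σ` ARE Liu's local theta types of ONE global line -/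

set_option synthInstance.maxHeartbeats 400000 in
set_option maxHeartbeats 8000000 in
/-- **CE_R — the automorphic core of CE** (the hypothesis `hR` of F0P2-p01 (g3)'s `F0P2cStubCEOfLocalThetaTypes.stubCE_of_localThetaTypes`, token-identical
up to the proof term of the frame relation fed to `localCongr`, which is proof-irrelevant): for `σ` the admissible finite component of a discrete `P` of
(anti)holomorphic cotangent type, ∃ `μ` conjugate-symplectic of weight one, ONE GLOBAL line `a ∈ (L⁺)ˣ` and `χ` such that at EVERY finite `v` the
`ℂ[U(H)(L⁺_v)]`-module `σ ∘ inclPlace v` is `X_v(μ,a,χ) ∘ κ_v⁻¹`-isotypic (`X_v` = Liu's local theta type on `U(diag dV)(L⁺_v)`: the `χ_W`-twisted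
coinvariants of the local Weil representation of the `θ_μ`-attached CM family at the line `⟨a⟩`, restricted along `k ↦ k ⊗ 1`; `κ_v` the frame congruence).
[cite: Rogawski1990, Thm 13.3.6 (c), §12.3, §13.3] [cite: GelbartRogawski1991, Thm 5.1.1, Lem 5.1.2] [cite: Liu2021, Def 4.11, App. D Lem D.1 (1)(3)] -/
def CoreCER : Prop :=
  ∀ (L : Type) [Field L] [NumberField L] [IsCMField L] (ι : L →+* ℂ) (H : Matrix (Fin 3) (Fin 3) L) (T : GL (Fin 3) ℂ)
    (hT : (T : Matrix (Fin 3) (Fin 3) ℂ)ᴴ * H.map ι * (T : Matrix (Fin 3) (Fin 3) ℂ) = Literature.Geometry.ComplexHyperbolic.BallModel.J),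
    (∀ τ' : L →+* ℂ, InfinitePlace.mk τ' ≠ InfinitePlace.mk ι → (H.map τ').PosDef) → 2 ≤ Module.finrank ℚ ↥(maximalRealSubfield L) →
    ∀ {n' : ℕ} (e₁ : Fin 3 × Fin 1 ≃ Fin n') (dV : Fin 3 → L) (hdV : ∀ i, IsCMField.complexConj L (dV i) = dV i)
      (hdV0 : ∀ i, dV i ≠ 0) (g : GL (Fin 3) L)
      (hg : ((g : Matrix (Fin 3) (Fin 3) L).map (cmConjRingHom L))ᵀ * H * (g : Matrix (Fin 3) (Fin 3) L) = Matrix.diagonal dV)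
      (ιV : finAdelic (↥(maximalRealSubfield L)) L (IsCMField.complexConj L) 3 H →*
          finAdelic (↥(maximalRealSubfield L)) L (IsCMField.complexConj L) 3 (Matrix.diagonal dV)),
        (∀ k, ((ιV k : finAdelic (↥(maximalRealSubfield L)) L (IsCMField.complexConj L) 3 (Matrix.diagonal dV)) :
            GL (Fin 3) (FiniteAdeleRing (𝓞 L) L)) =
          (toFinAdeleGL L 3 g)⁻¹ * (k : GL (Fin 3) (FiniteAdeleRing (𝓞 L) L)) * toFinAdeleGL L 3 g) →
        ∀ (μ : Measure (adelicGroupData (↥(maximalRealSubfield L)) L (IsCMField.complexConj L) 3 H).automorphicQuotient)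
          [(adelicGroupData (↥(maximalRealSubfield L)) L (IsCMField.complexConj L) 3 H).IsAutomorphicMeasure μ]
          (W : Type) [AddCommGroup W] [Module ℂ W]
          (σ : Representation ℂ (finAdelic (↥(maximalRealSubfield L)) L (IsCMField.complexConj L) 3 H) W),
          σ.IsIrreducible → σ.IsSmooth → σ.IsAdmissible →
          ∀ P : DiscreteAutomorphicRep (adelicGroupData (↥(maximalRealSubfield L)) L (IsCMField.complexConj L) 3 H) μ,
            (P.IsHolCotangentAt (cmArchSection L ι H T hT) (cmCompactFactor L ι H T hT) ∨
              P.IsAntiholCotangentAt (cmArchSection L ι H T hT) (cmCompactFactor L ι H T hT)) →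
            P.HasFinComponent σ →
            ∃ (μ : Literature.NumberTheory.Automorphic.IdeleClassGroup L →ₜ* Circle) (hμ : IsConjugateSymplectic L μ), HasWeight L μ 1 ∧
              ∃ (a : (↥(maximalRealSubfield L))ˣ) (χ : Chi (↥(maximalRealSubfield L)) L (IsCMField.complexConj L)),
                ∀ (v : HeightOneSpectrum (𝓞 ↥(maximalRealSubfield L))),
                  isotypicComponent (MonoidAlgebra ℂ (localPi L (IsCMField.complexConj L) 3 H v))
                    (Representation.asModule (σ.comp (inclPlace (↥(maximalRealSubfield L)) L (IsCMField.complexConj L) 3 H v)))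
                    (Representation.asModule
                      (((show Representation ℂ (localPi L (IsCMField.complexConj L) 3 (Matrix.diagonal dV) v) _ from
                        (TwistedCoinv.rep (localCharOfCenter (↥(maximalRealSubfield L)) L (IsCMField.complexConj L)
                            (JW (↥(maximalRealSubfield L)) L a) (JW_apply_ne_zero (↥(maximalRealSubfield L)) L a) χ.1 v)
                          ((OmegaChiSplitting.chiLocalSplittingsD ⟨L⟩ e₁ dV hdV hdV0 (toHeckeCharacter L μ)
                            ((isOscillatorChar_toHeckeCharacter_iff μ).mpr hμ) a).omegaLoc v)
                          (commute_omegaLoc_localCenter (↥(maximalRealSubfield L)) L (IsCMField.complexConj L) 3 e₁ (Matrix.diagonal dV)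
                            (JW (↥(maximalRealSubfield L)) L a) (complexConj_imagUnit L) (imagUnit_ne_zero L) (imagUnit_mul_self L)
                            (realDiagonal_isSymm L dV hdV) (isSymm_TW (↥(maximalRealSubfield L)) a) (realDiagonal_map L dV hdV).symm
                            (JW_eq (↥(maximalRealSubfield L)) L a) (JW_apply_ne_zero (↥(maximalRealSubfield L)) L a)
                            (OmegaChiSplitting.chiLocalSplittingsD ⟨L⟩ e₁ dV hdV hdV0 (toHeckeCharacter L μ)
                              ((isOscillatorChar_toHeckeCharacter_iff μ).mpr hμ) a) v)).comp
                          (UnitaryGroup.localLineInl L (IsCMField.complexConj L) 3 e₁ (Matrix.diagonal dV) (JW (↥(maximalRealSubfield L)) L a) v)) :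
                          localPi L (IsCMField.complexConj L) 3 (Matrix.diagonal dV) v →* _).comp
                        (localCongr L (IsCMField.complexConj L) g one_ne_zero
                          (F0P2cOmegaLocalType.formCongr_frame L H dV g hg) v).symm.toMulEquiv.toMonoidHom)) = ⊤

/-! ## §2 The registered stubs of the rung-2 road PK + GL + LW + LT (+ CER) ⇒ CE -/

set_option synthInstance.maxHeartbeats 400000 in
set_option maxHeartbeats 8000000 in
/-- **stub PK — ENGINE LETTER (class U), the PLACE-BY-PLACE form of CE**: same telescope, but the conclusion asks only for LOCAL classes: ∃ `μ`
(conjugate-symplectic, weight one), `χ`, a family of representatives `ε_v ∈ (L⁺)ˣ` (one per finite place; only the class of `ε_v` in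
`L⁺_vˣ ⧸ N(L_vˣ)` matters) and a base line `a₀` agreeing with `ε_v` in class at ALMOST EVERY `v`, such that `σ ∘ inclPlace v` is
`X_v(μ, ε_v, χ) ∘ κ_v⁻¹`-isotypic at EVERY `v`.  = «`σ_v` lies in the local A-packet `Π(ξ_v) = {πⁿ(ξ_v), πˢ(ξ_v)}` with `πⁿ` at almost all `v`»
[Rogawski1990 Thm 13.3.6 (c), 13.1.1] ∘ «the two members are the two local theta lifts `X_v(μ, a^±_v, χ)` of the two line classes» [GelbartRogawski1991
Thm 5.1.1 ∕ Lem 5.1.2; HarrisKudlaSweet1996 Thm 6.1] — with NO Hasse principle, NO global line, NO `rhoAtLine` in it.  PK ⇐ CE_R trivially (`ε_v := a`);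
CE_R ⇐ PK + GL + LW + LT below.  Why it might fail AS TYPED: only through a mismatch of normalisations (`χ.1`, `ψ`, `δ = imagUnit L`) between the engine's
packet labels and `X_v` — the statement itself is implied by the registered CE over the tree (CL ★ + CE-L), so it is not stronger than what the floor
already bets on. [cite: Rogawski1990, Thm 13.3.6 (c), Thm 13.1.1, §12.2] [cite: GelbartRogawski1991, Thm 5.1.1, Lem 5.1.2] [cite: HarrisKudlaSweet1996, Thm 6.1] -/
def StubPKLocalThetaClasses : Prop :=
  ∀ (L : Type) [Field L] [NumberField L] [IsCMField L] (ι : L →+* ℂ) (H : Matrix (Fin 3) (Fin 3) L) (T : GL (Fin 3) ℂ)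
    (hT : (T : Matrix (Fin 3) (Fin 3) ℂ)ᴴ * H.map ι * (T : Matrix (Fin 3) (Fin 3) ℂ) = Literature.Geometry.ComplexHyperbolic.BallModel.J),
    (∀ τ' : L →+* ℂ, InfinitePlace.mk τ' ≠ InfinitePlace.mk ι → (H.map τ').PosDef) → 2 ≤ Module.finrank ℚ ↥(maximalRealSubfield L) →
    ∀ {n' : ℕ} (e₁ : Fin 3 × Fin 1 ≃ Fin n') (dV : Fin 3 → L) (hdV : ∀ i, IsCMField.complexConj L (dV i) = dV i)
      (hdV0 : ∀ i, dV i ≠ 0) (g : GL (Fin 3) L)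
      (hg : ((g : Matrix (Fin 3) (Fin 3) L).map (cmConjRingHom L))ᵀ * H * (g : Matrix (Fin 3) (Fin 3) L) = Matrix.diagonal dV)
      (ιV : finAdelic (↥(maximalRealSubfield L)) L (IsCMField.complexConj L) 3 H →*
          finAdelic (↥(maximalRealSubfield L)) L (IsCMField.complexConj L) 3 (Matrix.diagonal dV)),
        (∀ k, ((ιV k : finAdelic (↥(maximalRealSubfield L)) L (IsCMField.complexConj L) 3 (Matrix.diagonal dV)) :
            GL (Fin 3) (FiniteAdeleRing (𝓞 L) L)) =
          (toFinAdeleGL L 3 g)⁻¹ * (k : GL (Fin 3) (FiniteAdeleRing (𝓞 L) L)) * toFinAdeleGL L 3 g) →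
        ∀ (μ : Measure (adelicGroupData (↥(maximalRealSubfield L)) L (IsCMField.complexConj L) 3 H).automorphicQuotient)
          [(adelicGroupData (↥(maximalRealSubfield L)) L (IsCMField.complexConj L) 3 H).IsAutomorphicMeasure μ]
          (W : Type) [AddCommGroup W] [Module ℂ W]
          (σ : Representation ℂ (finAdelic (↥(maximalRealSubfield L)) L (IsCMField.complexConj L) 3 H) W),
          σ.IsIrreducible → σ.IsSmooth → σ.IsAdmissible →
          ∀ P : DiscreteAutomorphicRep (adelicGroupData (↥(maximalRealSubfield L)) L (IsCMField.complexConj L) 3 H) μ,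
            (P.IsHolCotangentAt (cmArchSection L ι H T hT) (cmCompactFactor L ι H T hT) ∨
              P.IsAntiholCotangentAt (cmArchSection L ι H T hT) (cmCompactFactor L ι H T hT)) →
            P.HasFinComponent σ →
            ∃ (μ : Literature.NumberTheory.Automorphic.IdeleClassGroup L →ₜ* Circle) (hμ : IsConjugateSymplectic L μ), HasWeight L μ 1 ∧
              ∃ (χ : Chi (↥(maximalRealSubfield L)) L (IsCMField.complexConj L))
                (ε : HeightOneSpectrum (𝓞 ↥(maximalRealSubfield L)) → (↥(maximalRealSubfield L))ˣ) (a₀ : (↥(maximalRealSubfield L))ˣ),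
                (∀ᶠ v in Filter.cofinite, locF (↥(maximalRealSubfield L)) (imagUnitSq L) (ε v) v = locF (↥(maximalRealSubfield L)) (imagUnitSq L) a₀ v) ∧
                  ∀ (v : HeightOneSpectrum (𝓞 ↥(maximalRealSubfield L))),
                    isotypicComponent (MonoidAlgebra ℂ (localPi L (IsCMField.complexConj L) 3 H v))
                      (Representation.asModule (σ.comp (inclPlace (↥(maximalRealSubfield L)) L (IsCMField.complexConj L) 3 H v)))
                      (Representation.asModule
                        (((show Representation ℂ (localPi L (IsCMField.complexConj L) 3 (Matrix.diagonal dV) v) _ from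
                          (TwistedCoinv.rep (localCharOfCenter (↥(maximalRealSubfield L)) L (IsCMField.complexConj L)
                              (JW (↥(maximalRealSubfield L)) L (ε v)) (JW_apply_ne_zero (↥(maximalRealSubfield L)) L (ε v)) χ.1 v)
                            ((OmegaChiSplitting.chiLocalSplittingsD ⟨L⟩ e₁ dV hdV hdV0 (toHeckeCharacter L μ)
                              ((isOscillatorChar_toHeckeCharacter_iff μ).mpr hμ) (ε v)).omegaLoc v)
                            (commute_omegaLoc_localCenter (↥(maximalRealSubfield L)) L (IsCMField.complexConj L) 3 e₁ (Matrix.diagonal dV)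
                              (JW (↥(maximalRealSubfield L)) L (ε v)) (complexConj_imagUnit L) (imagUnit_ne_zero L) (imagUnit_mul_self L)
                              (realDiagonal_isSymm L dV hdV) (isSymm_TW (↥(maximalRealSubfield L)) (ε v)) (realDiagonal_map L dV hdV).symm
                              (JW_eq (↥(maximalRealSubfield L)) L (ε v)) (JW_apply_ne_zero (↥(maximalRealSubfield L)) L (ε v))
                              (OmegaChiSplitting.chiLocalSplittingsD ⟨L⟩ e₁ dV hdV hdV0 (toHeckeCharacter L μ)
                                ((isOscillatorChar_toHeckeCharacter_iff μ).mpr hμ) (ε v)) v)).comp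
                            (UnitaryGroup.localLineInl L (IsCMField.complexConj L) 3 e₁ (Matrix.diagonal dV) (JW (↥(maximalRealSubfield L)) L (ε v)) v)) :
                            localPi L (IsCMField.complexConj L) 3 (Matrix.diagonal dV) v →* _).comp
                          (localCongr L (IsCMField.complexConj L) g one_ne_zero
                            (F0P2cOmegaLocalType.formCongr_frame L H dV g hg) v).symm.toMulEquiv.toMonoidHom)) = ⊤

/-- **stub GL — cofinite families of local norm classes are GLOBAL (in-house, S)**: if the classes of `ε_v` agree with those of ONE `a₀` off a
finite set, some `a ∈ (L⁺)ˣ` has the class of `ε_v` at EVERY finite `v`.  Proof plan: `ε′_v := [ε_v][a₀]⁻¹` is a finitely supported family in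
`Eps L⁺ δ²`; ★ `QuadraticForms.exists_prescribed_normClass_of_finite` (K = L⁺, a = imagUnitSq L — negative at every real place by ★
`Def412AdmissibleIffParity.embedding_of_isReal_lt_zero_of_coe_eq_mul_self`; `w₀` = any real place of the totally real `L⁺`; the real signs of `θ`
absorb the parity) gives `θ` with `locF θ = ε′`; take `a := θ a₀` (`locF` is a group homomorphism).  ARCHIMEDEAN CLASSES FREE: CE constrains `a` at
finite places only. [cite: Omeara1963, §65 Prop. 65:21, §71 Thm. 71:19, Cor. 71:19a] [cite: Liu2021, Def 4.12 (l. 2105), Rem 4.14] -/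
def StubGLGlobalLine : Prop :=
  ∀ (L : Type) [Field L] [NumberField L] [IsCMField L]
    (ε : HeightOneSpectrum (𝓞 ↥(maximalRealSubfield L)) → (↥(maximalRealSubfield L))ˣ) (a₀ : (↥(maximalRealSubfield L))ˣ),
    (∀ᶠ v in Filter.cofinite, locF (↥(maximalRealSubfield L)) (imagUnitSq L) (ε v) v = locF (↥(maximalRealSubfield L)) (imagUnitSq L) a₀ v) →
      ∃ a : (↥(maximalRealSubfield L))ˣ, ∀ v : HeightOneSpectrum (𝓞 ↥(maximalRealSubfield L)), locF (↥(maximalRealSubfield L)) (imagUnitSq L) a v = locF (↥(maximalRealSubfield L)) (imagUnitSq L) (ε v) v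

/-- **stub LW — the local norm witness at ONE place (in-house, S)**: two lines of the same class at `v` differ by a local norm: a unit `x` of
`L ⊗ L⁺_v = ∏_{w ∣ v} L_w` with `a₂⁻¹ δ = x xᶜ · a₁⁻¹ δ` — the `hx` shape consumed by ★ `lineTransportSplitting_lineTransportSection_congrW_undoubledSplittings_holds`
(S6a) and ★ `lineTransportOp_omegaLoc_localLineInl'`.  Proof plan: the `v`-component of ★ `QuadraticLocalNormWitnessFamily.exists_localRing_units_lineDelta_eq`'s
construction (`a₁ a₂⁻¹ ∈ quadraticNormSubgroup L⁺_v (δ²)` ⇒ `a₁ a₂⁻¹ = p² − δ² q²`, `x := p + q δ`); no Hasse. [cite: Omeara1963, §63 Ex. 63:14, §65A Ex. 65:2]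
[cite: Liu2021, App. D §D.1 Step 1 (l. 5217), Lem D.1 (3)] -/
def StubLWLocalWitness : Prop :=
  ∀ (L : Type) [Field L] [NumberField L] [IsCMField L] (a₁ a₂ : (↥(maximalRealSubfield L))ˣ)
    (v : HeightOneSpectrum (𝓞 ↥(maximalRealSubfield L))),
    locF (↥(maximalRealSubfield L)) (imagUnitSq L) a₁ v = locF (↥(maximalRealSubfield L)) (imagUnitSq L) a₂ v →
      ∃ x : (LocalRing L v)ˣ,
        algebraMap L (LocalRing L v) (algebraMap (↥(maximalRealSubfield L)) L (↑a₂⁻¹ : ↥(maximalRealSubfield L)) * imagUnit L) =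
        (x : LocalRing L v) * conjLocal L (IsCMField.complexConj L) v x *
          algebraMap L (LocalRing L v) (algebraMap (↥(maximalRealSubfield L)) L (↑a₁⁻¹ : ↥(maximalRealSubfield L)) * imagUnit L)

set_option synthInstance.maxHeartbeats 400000 in
set_option maxHeartbeats 8000000 in
/-- **node LT — Liu's local theta type depends only on the LOCAL CLASS of the line (in-house, M; the theta content of the road; DERIVED from the
registered stubs LR + LTpu by `lt_of_LR_LTpu`, §4 — F0P2-p02 (g2) census 2026-08-31T02:52:40Z, option (b))**: for lines
`a₁, a₂` related at `v` by a norm witness `x` (stub LW), `X_v(μ, a₁, χ) ≃ X_v(μ, a₂, χ)` as representations of `U(diag dV)(L⁺_v)` (Mathlib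
`Representation.Equiv`).  [Liu2021 Lem D.1 (3)]: «another representative gives an isomorphic representation», PLACE BY PLACE.  Proof plan (assembly of ★
bricks): the operator `M_x = MoeglinVignerasWaldspurger1987.lineTransportOp … x …` IS a `ℂ`-linear equivalence of `𝒮(L⁺_vᴺ)` (★ def, `≃ₗ[ℂ]`); it intertwines
the two local Weil representations along `k ↦ k ⊗ 1` (★ `lineTransportOp_omegaLoc_localLineInl'` over ★ S6a, stated at the enumeration `Equiv.prodUnique`;
transport to `e₁` by the local form of ★ `Def411WeilCarriersAtLineReindex` or by the generic ★ `lineTransportOp_omegaLoc_localLineInl_of_eq`) and the two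
local centre actions (★ `lineTransportOp_omegaLoc_localCenter`), hence descends to the `χ_W`-twisted coinvariants (★ `TwistedCoinv.mapEquiv` ∕ `mapEquiv_rep`,
cf. ★ `TwistedCoinv.exists_equivariant_of_equivariant`, ★ `areIsomorphicRep_theta_lineTransportSplitting`); package as `Representation.Equiv.mk`.  Why it might
fail: only bookkeeping — the reindexing `e₁` vs `Equiv.prodUnique (Fin 3) (Fin 1)` of the ★ intertwiner, and the `localCharOfCenter … χ.1` twist being the SAME
character on both sides (it is: it does not depend on the line). [cite: MoeglinVignerasWaldspurger1987, Chap. 2 II.1 (A)–(B), Chap. 3 I.1–I.3, IV.4]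
[cite: Liu2021, App. D Lem D.1 (3) (l. 5233)] [cite: Kudla1994, §3 Thm 3.1] -/
def StubLTLocalTypeTransport : Prop :=
  ∀ (L : Type) [Field L] [NumberField L] [IsCMField L] {n' : ℕ} (e₁ : Fin 3 × Fin 1 ≃ Fin n') (dV : Fin 3 → L)
    (hdV : ∀ i, IsCMField.complexConj L (dV i) = dV i) (hdV0 : ∀ i, dV i ≠ 0)
    (μ : Literature.NumberTheory.Automorphic.IdeleClassGroup L →ₜ* Circle) (hμ : IsConjugateSymplectic L μ)
    (a₁ a₂ : (↥(maximalRealSubfield L))ˣ) (χ : Chi (↥(maximalRealSubfield L)) L (IsCMField.complexConj L))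
    (v : HeightOneSpectrum (𝓞 ↥(maximalRealSubfield L))) (x : (LocalRing L v)ˣ),
    algebraMap L (LocalRing L v) (algebraMap (↥(maximalRealSubfield L)) L (↑a₂⁻¹ : ↥(maximalRealSubfield L)) * imagUnit L) =
        (x : LocalRing L v) * conjLocal L (IsCMField.complexConj L) v x *
          algebraMap L (LocalRing L v) (algebraMap (↥(maximalRealSubfield L)) L (↑a₁⁻¹ : ↥(maximalRealSubfield L)) * imagUnit L) →
      Nonempty (Representation.Equiv
        (show Representation ℂ (localPi L (IsCMField.complexConj L) 3 (Matrix.diagonal dV) v) _ from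
          (TwistedCoinv.rep (localCharOfCenter (↥(maximalRealSubfield L)) L (IsCMField.complexConj L)
              (JW (↥(maximalRealSubfield L)) L a₁) (JW_apply_ne_zero (↥(maximalRealSubfield L)) L a₁) χ.1 v)
            ((OmegaChiSplitting.chiLocalSplittingsD ⟨L⟩ e₁ dV hdV hdV0 (toHeckeCharacter L μ)
              ((isOscillatorChar_toHeckeCharacter_iff μ).mpr hμ) a₁).omegaLoc v)
            (commute_omegaLoc_localCenter (↥(maximalRealSubfield L)) L (IsCMField.complexConj L) 3 e₁ (Matrix.diagonal dV)
              (JW (↥(maximalRealSubfield L)) L a₁) (complexConj_imagUnit L) (imagUnit_ne_zero L) (imagUnit_mul_self L)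
              (realDiagonal_isSymm L dV hdV) (isSymm_TW (↥(maximalRealSubfield L)) a₁) (realDiagonal_map L dV hdV).symm
              (JW_eq (↥(maximalRealSubfield L)) L a₁) (JW_apply_ne_zero (↥(maximalRealSubfield L)) L a₁)
              (OmegaChiSplitting.chiLocalSplittingsD ⟨L⟩ e₁ dV hdV hdV0 (toHeckeCharacter L μ)
                ((isOscillatorChar_toHeckeCharacter_iff μ).mpr hμ) a₁) v)).comp
            (UnitaryGroup.localLineInl L (IsCMField.complexConj L) 3 e₁ (Matrix.diagonal dV) (JW (↥(maximalRealSubfield L)) L a₁) v))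
        (show Representation ℂ (localPi L (IsCMField.complexConj L) 3 (Matrix.diagonal dV) v) _ from
          (TwistedCoinv.rep (localCharOfCenter (↥(maximalRealSubfield L)) L (IsCMField.complexConj L)
              (JW (↥(maximalRealSubfield L)) L a₂) (JW_apply_ne_zero (↥(maximalRealSubfield L)) L a₂) χ.1 v)
            ((OmegaChiSplitting.chiLocalSplittingsD ⟨L⟩ e₁ dV hdV hdV0 (toHeckeCharacter L μ)
              ((isOscillatorChar_toHeckeCharacter_iff μ).mpr hμ) a₂).omegaLoc v)
            (commute_omegaLoc_localCenter (↥(maximalRealSubfield L)) L (IsCMField.complexConj L) 3 e₁ (Matrix.diagonal dV)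
              (JW (↥(maximalRealSubfield L)) L a₂) (complexConj_imagUnit L) (imagUnit_ne_zero L) (imagUnit_mul_self L)
              (realDiagonal_isSymm L dV hdV) (isSymm_TW (↥(maximalRealSubfield L)) a₂) (realDiagonal_map L dV hdV).symm
              (JW_eq (↥(maximalRealSubfield L)) L a₂) (JW_apply_ne_zero (↥(maximalRealSubfield L)) L a₂)
              (OmegaChiSplitting.chiLocalSplittingsD ⟨L⟩ e₁ dV hdV hdV0 (toHeckeCharacter L μ)
                ((isOscillatorChar_toHeckeCharacter_iff μ).mpr hμ) a₂) v)).comp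
            (UnitaryGroup.localLineInl L (IsCMField.complexConj L) 3 e₁ (Matrix.diagonal dV) (JW (↥(maximalRealSubfield L)) L a₂) v)))

set_option synthInstance.maxHeartbeats 400000 in
set_option maxHeartbeats 8000000 in
/-- **stub LR — local RE-ENUMERATION (in-house, S∕M; F0P2-p02 (g2) census 2026-08-31T02:52:40Z (3)(b), F0P2-p04 (g3) claim 02:55:41Z)**: Liu's local
theta type does not depend on the enumeration `e : Fin 3 × Fin 1 ≃ Fin n` of the doubled coordinates — for all `e e'`,
`X_v(μ, a, χ)[e] ≃ X_v(μ, a, χ)[e']` as representations of `U(diag dV)(L⁺_v)`.  Every ★ local transport brick (`lineTransportOp`, S6a,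
`lineTransportOp_omegaLoc_localLineInl'`) is typed at `Equiv.prodUnique (Fin N) (Fin 1)`; LR carries them to the registered generality.  Road (global route,
p02∕p04): ★ `Def411WeilCarriersDoubling.exists_omegaAtLine_equiv_rhoVAtLine_reindex` (carriers at `e`, `e'` isomorphic, `rhoVAtLine`-equivariantly) + ★
`isotypicComponent_rhoAtLine_comp_eq_top_of_factors` at each enumeration + ★ `Liu2021.nonempty_equiv_of_isotypicComponent_eq_top` (uniqueness of irreducible
local types); local route = naturality of Kudla's CM package under `Matrix.reindex` (L).  Statement text = F0P2-p02 (g2)'s consumed hypothesis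
`F0/P2/LR.hypothesis.F0P2p02g2.txt` (sha16 2742663972df4771) token for token.  Why it might fail: bookkeeping only (the adelic reindex lemmas are ★; the
descent to one place goes through pure tensors ∕ `localRefSection`). [cite: Liu2021, Def 4.11, App. D Lem D.1 (1)] [cite: Kudla1994, §3 Thm 3.1] -/
def StubLRLocalReindex : Prop :=
  ∀ (L : Type) [Field L] [NumberField L] [IsCMField L] {n n' : ℕ} (e : Fin 3 × Fin 1 ≃ Fin n) (e' : Fin 3 × Fin 1 ≃ Fin n')
    (dV : Fin 3 → L) (hdV : ∀ i, IsCMField.complexConj L (dV i) = dV i) (hdV0 : ∀ i, dV i ≠ 0)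
    (μ : Literature.NumberTheory.Automorphic.IdeleClassGroup L →ₜ* Circle) (hμ : IsConjugateSymplectic L μ)
    (a : (↥(maximalRealSubfield L))ˣ) (χ : Chi (↥(maximalRealSubfield L)) L (IsCMField.complexConj L))
    (v : HeightOneSpectrum (𝓞 ↥(maximalRealSubfield L))),
    Nonempty (Representation.Equiv
      (show Representation ℂ (localPi L (IsCMField.complexConj L) 3 (Matrix.diagonal dV) v) _ from
        (TwistedCoinv.rep (localCharOfCenter (↥(maximalRealSubfield L)) L (IsCMField.complexConj L)
            (JW (↥(maximalRealSubfield L)) L a) (JW_apply_ne_zero (↥(maximalRealSubfield L)) L a) χ.1 v)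
          ((OmegaChiSplitting.chiLocalSplittingsD ⟨L⟩ e dV hdV hdV0 (toHeckeCharacter L μ)
            ((isOscillatorChar_toHeckeCharacter_iff μ).mpr hμ) a).omegaLoc v)
          (commute_omegaLoc_localCenter (↥(maximalRealSubfield L)) L (IsCMField.complexConj L) 3 e (Matrix.diagonal dV)
            (JW (↥(maximalRealSubfield L)) L a) (complexConj_imagUnit L) (imagUnit_ne_zero L) (imagUnit_mul_self L)
            (realDiagonal_isSymm L dV hdV) (isSymm_TW (↥(maximalRealSubfield L)) a) (realDiagonal_map L dV hdV).symm
            (JW_eq (↥(maximalRealSubfield L)) L a) (JW_apply_ne_zero (↥(maximalRealSubfield L)) L a)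
            (OmegaChiSplitting.chiLocalSplittingsD ⟨L⟩ e dV hdV hdV0 (toHeckeCharacter L μ)
              ((isOscillatorChar_toHeckeCharacter_iff μ).mpr hμ) a) v)).comp
          (UnitaryGroup.localLineInl L (IsCMField.complexConj L) 3 e (Matrix.diagonal dV) (JW (↥(maximalRealSubfield L)) L a) v))
      (show Representation ℂ (localPi L (IsCMField.complexConj L) 3 (Matrix.diagonal dV) v) _ from
        (TwistedCoinv.rep (localCharOfCenter (↥(maximalRealSubfield L)) L (IsCMField.complexConj L)
            (JW (↥(maximalRealSubfield L)) L a) (JW_apply_ne_zero (↥(maximalRealSubfield L)) L a) χ.1 v)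
          ((OmegaChiSplitting.chiLocalSplittingsD ⟨L⟩ e' dV hdV hdV0 (toHeckeCharacter L μ)
            ((isOscillatorChar_toHeckeCharacter_iff μ).mpr hμ) a).omegaLoc v)
          (commute_omegaLoc_localCenter (↥(maximalRealSubfield L)) L (IsCMField.complexConj L) 3 e' (Matrix.diagonal dV)
            (JW (↥(maximalRealSubfield L)) L a) (complexConj_imagUnit L) (imagUnit_ne_zero L) (imagUnit_mul_self L)
            (realDiagonal_isSymm L dV hdV) (isSymm_TW (↥(maximalRealSubfield L)) a) (realDiagonal_map L dV hdV).symm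
            (JW_eq (↥(maximalRealSubfield L)) L a) (JW_apply_ne_zero (↥(maximalRealSubfield L)) L a)
            (OmegaChiSplitting.chiLocalSplittingsD ⟨L⟩ e' dV hdV hdV0 (toHeckeCharacter L μ)
              ((isOscillatorChar_toHeckeCharacter_iff μ).mpr hμ) a) v)).comp
          (UnitaryGroup.localLineInl L (IsCMField.complexConj L) 3 e' (Matrix.diagonal dV) (JW (↥(maximalRealSubfield L)) L a) v)))

set_option synthInstance.maxHeartbeats 400000 in
set_option maxHeartbeats 8000000 in
/-- **stub LTpu — local type transport AT THE ENUMERATION `Equiv.prodUnique (Fin 3) (Fin 1)` (in-house, M; F0P2-p02 (g2), report-first GREEN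
2026-08-31T03:03:55Z rf 08439ffa1cbd5373 `F0P2eStubLTLocalTypeTransport.stubLT_prodUnique_holds`, F0P2-ref1 r52 (b) PRE-CERT)**: the registered LT body
with the binder `{n'} (e₁ : Fin 3 × Fin 1 ≃ Fin n')` deleted and `e₁ ↦ Equiv.prodUnique (Fin 3) (Fin 1)` — where ★ `lineTransportOp_omegaLoc_localLineInl'`
(over ★ S6a) and the centre bridge ★ `LemD1OfPlace.ker_localCenter_eq_of_line` + ★ `TwistedCoinv.mapEquiv` live.  LT = LTpu ∘ LR ∘ LR (`lt_of_LR_LTpu`, §4).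
[cite: MoeglinVignerasWaldspurger1987, Chap. 2 II.1 (A)–(B), Chap. 3 I.1–I.3, IV.4] [cite: Liu2021, App. D Lem D.1 (3)] -/
def StubLTProdUnique : Prop :=
  ∀ (L : Type) [Field L] [NumberField L] [IsCMField L] (dV : Fin 3 → L)
    (hdV : ∀ i, IsCMField.complexConj L (dV i) = dV i) (hdV0 : ∀ i, dV i ≠ 0)
    (μ : Literature.NumberTheory.Automorphic.IdeleClassGroup L →ₜ* Circle) (hμ : IsConjugateSymplectic L μ)
    (a₁ a₂ : (↥(maximalRealSubfield L))ˣ) (χ : Chi (↥(maximalRealSubfield L)) L (IsCMField.complexConj L))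
    (v : HeightOneSpectrum (𝓞 ↥(maximalRealSubfield L))) (x : (LocalRing L v)ˣ),
    algebraMap L (LocalRing L v) (algebraMap (↥(maximalRealSubfield L)) L (↑a₂⁻¹ : ↥(maximalRealSubfield L)) * imagUnit L) =
        (x : LocalRing L v) * conjLocal L (IsCMField.complexConj L) v x *
          algebraMap L (LocalRing L v) (algebraMap (↥(maximalRealSubfield L)) L (↑a₁⁻¹ : ↥(maximalRealSubfield L)) * imagUnit L) →
      Nonempty (Representation.Equiv
        (show Representation ℂ (localPi L (IsCMField.complexConj L) 3 (Matrix.diagonal dV) v) _ from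
          (TwistedCoinv.rep (localCharOfCenter (↥(maximalRealSubfield L)) L (IsCMField.complexConj L)
              (JW (↥(maximalRealSubfield L)) L a₁) (JW_apply_ne_zero (↥(maximalRealSubfield L)) L a₁) χ.1 v)
            ((OmegaChiSplitting.chiLocalSplittingsD ⟨L⟩ (Equiv.prodUnique (Fin 3) (Fin 1)) dV hdV hdV0 (toHeckeCharacter L μ)
              ((isOscillatorChar_toHeckeCharacter_iff μ).mpr hμ) a₁).omegaLoc v)
            (commute_omegaLoc_localCenter (↥(maximalRealSubfield L)) L (IsCMField.complexConj L) 3 (Equiv.prodUnique (Fin 3) (Fin 1)) (Matrix.diagonal dV)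
              (JW (↥(maximalRealSubfield L)) L a₁) (complexConj_imagUnit L) (imagUnit_ne_zero L) (imagUnit_mul_self L)
              (realDiagonal_isSymm L dV hdV) (isSymm_TW (↥(maximalRealSubfield L)) a₁) (realDiagonal_map L dV hdV).symm
              (JW_eq (↥(maximalRealSubfield L)) L a₁) (JW_apply_ne_zero (↥(maximalRealSubfield L)) L a₁)
              (OmegaChiSplitting.chiLocalSplittingsD ⟨L⟩ (Equiv.prodUnique (Fin 3) (Fin 1)) dV hdV hdV0 (toHeckeCharacter L μ)
                ((isOscillatorChar_toHeckeCharacter_iff μ).mpr hμ) a₁) v)).comp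
            (UnitaryGroup.localLineInl L (IsCMField.complexConj L) 3 (Equiv.prodUnique (Fin 3) (Fin 1)) (Matrix.diagonal dV) (JW (↥(maximalRealSubfield L)) L a₁) v))
        (show Representation ℂ (localPi L (IsCMField.complexConj L) 3 (Matrix.diagonal dV) v) _ from
          (TwistedCoinv.rep (localCharOfCenter (↥(maximalRealSubfield L)) L (IsCMField.complexConj L)
              (JW (↥(maximalRealSubfield L)) L a₂) (JW_apply_ne_zero (↥(maximalRealSubfield L)) L a₂) χ.1 v)
            ((OmegaChiSplitting.chiLocalSplittingsD ⟨L⟩ (Equiv.prodUnique (Fin 3) (Fin 1)) dV hdV hdV0 (toHeckeCharacter L μ)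
              ((isOscillatorChar_toHeckeCharacter_iff μ).mpr hμ) a₂).omegaLoc v)
            (commute_omegaLoc_localCenter (↥(maximalRealSubfield L)) L (IsCMField.complexConj L) 3 (Equiv.prodUnique (Fin 3) (Fin 1)) (Matrix.diagonal dV)
              (JW (↥(maximalRealSubfield L)) L a₂) (complexConj_imagUnit L) (imagUnit_ne_zero L) (imagUnit_mul_self L)
              (realDiagonal_isSymm L dV hdV) (isSymm_TW (↥(maximalRealSubfield L)) a₂) (realDiagonal_map L dV hdV).symm
              (JW_eq (↥(maximalRealSubfield L)) L a₂) (JW_apply_ne_zero (↥(maximalRealSubfield L)) L a₂)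
              (OmegaChiSplitting.chiLocalSplittingsD ⟨L⟩ (Equiv.prodUnique (Fin 3) (Fin 1)) dV hdV hdV0 (toHeckeCharacter L μ)
                ((isOscillatorChar_toHeckeCharacter_iff μ).mpr hμ) a₂) v)).comp
            (UnitaryGroup.localLineInl L (IsCMField.complexConj L) 3 (Equiv.prodUnique (Fin 3) (Fin 1)) (Matrix.diagonal dV) (JW (↥(maximalRealSubfield L)) L a₂) v)))

/-- delta-alias of the derived node LT (see §2b: `lt_of_LR_LTpu` concludes it; only `stub_LT_localTypeTransport` concludes `StubLTLocalTypeTransport`). -/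
def LTRecorded : Prop :=
  StubLTLocalTypeTransport

/-- **stub CER — CE from its automorphic core** (`CoreCER → CE`): ★ p805164 F0P2-p01 (g3) `F0P2cStubCEOfLocalThetaTypes.stubCE_of_localThetaTypes`
(commit 144daf63fd79; F0P2-ref1 r48 pre-cert) over ★ p803803 CE-L `F0P2cOmegaLocalType.isLocalTypeAt_rhoAtLine_chi` (`ω_H ∘ inclPlace v` is
`X_v ∘ κ_v⁻¹`-isotypic, `X_v ∘ κ_v⁻¹` irreducible — unconditional), uniqueness of irreducible local types (★ `Liu2021.nonempty_equiv_of_isotypicComponent_eq_top`)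
and ★ `isotypicComponent_asModule_congr_type`.  FOLDED BY NAME in §3: `theorem stub_CER_coreToCE : StubCERCoreToCE := fun hR =>
F0P2cStubCEOfLocalThetaTypes.stubCE_of_localThetaTypes hR` (`CETarget` and `IsLocalTypeAt` unfold definitionally). [cite: Liu2021, Thm 4.18 (2) (l. 2270), App. D Lem D.1 (1)] [cite: Flath1979, Thm 3]
[cite: Bump1997, §3.4 Prop 3.4.1] -/
def StubCERCoreToCE : Prop :=
  CoreCER → CETarget

/-! ## §2b Recording aliases — «exactly ONE `theorem` concludes a statement-of-record constant per checked file» (registrar A-plan1 (g18), R3 2026-08-31T02:52:02Z: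
the skeleton checker takes the FIRST theorem, in environment-fold order, whose conclusion head is the crux constant).  The implication-form heads below
conclude these delta-aliases; only `stubCE_of_rung2_stubs` concludes `CETarget` (= the (C)-line՚s `StubCELocalTypesTheta`, δ) and only
`stub_PK_localThetaClasses` concludes `StubPKLocalThetaClasses`; the derived node LT likewise (`lt_of_LR_LTpu : … → LTRecorded`, `stub_LT_localTypeTransport`
its one concluder). -/

/-- delta-alias of the registered letter CE (see §2b). [cite: Rogawski1990, Thm 13.3.6 (c)] -/
def CERecorded : Prop :=
  CETarget

/-- delta-alias of the engine letter PK (see §2b). [cite: Rogawski1990, Thm 13.3.6 (c)] -/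
def PKRecorded : Prop :=
  StubPKLocalThetaClasses

/-! ## §3 The stubs as theorems (`sorry` = open; ★ = folded by name) -/

/-- stub PK (ENGINE letter, class U — programme P3's S-layer ∘ the GR91 local dictionary; not a prover item on this floor). -/
theorem stub_PK_localThetaClasses : StubPKLocalThetaClasses := by
  sorry

set_option synthInstance.maxHeartbeats 400000 in
set_option maxHeartbeats 8000000 in
/-- stub GL — ★ FOLDED BY NAME (v1.1): p808695 F0P2-p03 (g3) `Theorems/F0P2eStubGLGlobalLine.lean :: stubGL_holds` (statement = `StubGLGlobalLine` body VERBATIM). -/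
theorem stub_GL_globalLine : StubGLGlobalLine :=
  Summit.HodgeConjecture.HodgeConjecture.Cruxes.H413.F0P2eStubGLGlobalLine.stubGL_holds

set_option synthInstance.maxHeartbeats 400000 in
set_option maxHeartbeats 8000000 in
/-- stub LW — ★ FOLDED BY NAME (v1.1): p808696 F0P2-p03 (g3) `Theorems/F0P2eStubLWLocalWitness.lean :: stubLW_holds` (statement = `StubLWLocalWitness` body VERBATIM). -/
theorem stub_LW_localWitness : StubLWLocalWitness :=
  Summit.HodgeConjecture.HodgeConjecture.Cruxes.H413.F0P2eStubLWLocalWitness.stubLW_holds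

set_option synthInstance.maxHeartbeats 400000 in
set_option maxHeartbeats 8000000 in
/-- stub LR — ★ FOLDED BY NAME (v1.1): p808692 F0P2-p04 (g3) `Theorems/F0P2eStubLRLocalReindex.lean :: stubLR_holds` (statement = `StubLRLocalReindex` body VERBATIM). -/
theorem stub_LR_localReindex : StubLRLocalReindex :=
  Summit.HodgeConjecture.HodgeConjecture.Cruxes.H413.F0P2eStubLRLocalReindex.stubLR_holds

set_option synthInstance.maxHeartbeats 400000 in
set_option maxHeartbeats 8000000 in
/-- stub LTpu — ★ FOLDED BY NAME (v1.1): p808809 F0P2-p02 (g2) `Theorems/F0P2eStubLTLocalTypeTransport.lean :: stubLT_prodUnique_holds` (statement = `StubLTProdUnique` body VERBATIM). -/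
theorem stub_LTpu_prodUnique : StubLTProdUnique :=
  Summit.HodgeConjecture.HodgeConjecture.Cruxes.H413.F0P2eStubLTLocalTypeTransport.stubLT_prodUnique_holds

set_option synthInstance.maxHeartbeats 400000 in
set_option maxHeartbeats 8000000 in
/-- stub CER — ★ FOLDED BY NAME: p805164 F0P2-p01 (g3) `F0P2cStubCEOfLocalThetaTypes.stubCE_of_localThetaTypes` (`CETarget` ∕ `IsLocalTypeAt` ∕ `CoreCER`
unfold definitionally against its hypothesis and conclusion). -/
theorem stub_CER_coreToCE : StubCERCoreToCE := by
  intro hR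
  exact Summit.HodgeConjecture.HodgeConjecture.Cruxes.H413.F0P2cStubCEOfLocalThetaTypes.stubCE_of_localThetaTypes hR

/-! ## §4 The kernel-checked compositions (no `sorry` below this line) -/

/-- **isotypy does not see the type within its isomorphism class — pulled back along any homomorphism**: for `E : ρ ≃ ρ'` (Mathlib
`Representation.Equiv`) and `φ : G' →* G`, the `ρ ∘ φ`- and `ρ' ∘ φ`-isotypic components of every `ℂ[G']`-module agree (★
`isotypicComponent_asModule_congr_type`). [cite: Bump1997, §3.4 Prop 3.4.1] -/
theorem isotypicComponent_comp_congr_of_equiv {G G' V V' W' : Type*} [Group G] [Group G'] [AddCommGroup V] [Module ℂ V]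
    [AddCommGroup V'] [Module ℂ V'] [AddCommGroup W'] [Module ℂ W'] {ρ : Representation ℂ G V} {ρ' : Representation ℂ G V'}
    (E : Representation.Equiv ρ ρ') (π : Representation ℂ G' W') (φ : G' →* G) :
    isotypicComponent (MonoidAlgebra ℂ G') (Representation.asModule π) (Representation.asModule (ρ.comp φ)) =
      isotypicComponent (MonoidAlgebra ℂ G') (Representation.asModule π) (Representation.asModule (ρ'.comp φ)) :=
  Literature.RepresentationTheory.isotypicComponent_asModule_congr_type π (ρ.comp φ) (ρ'.comp φ) E.toLinearEquiv fun g w => by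
    change E.toIntertwiningMap (ρ (φ g) w) = ρ' (φ g) (E.toIntertwiningMap w)
    exact Representation.IntertwiningMap.isIntertwining _ _ E.toIntertwiningMap (φ g) w

set_option synthInstance.maxHeartbeats 400000 in
set_option maxHeartbeats 8000000 in
/-- **LT = LTpu ∘ LR ∘ LR** (F0P2-p02 (g2)'s `stubLT_of_LR`, v2 rf 42246194a8c5a085 §3, GREEN): re-enumerate `e₁ ↦ prodUnique` at `a₁`, transport the
class at `prodUnique`, re-enumerate back at `a₂`; `Representation.Equiv.trans`. [cite: Liu2021, App. D Lem D.1 (3)] -/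
theorem lt_of_LR_LTpu (hLR : StubLRLocalReindex) (hLTpu : StubLTProdUnique) : LTRecorded := by
  show StubLTLocalTypeTransport
  intro L _ _ _ n' e₁ dV hdV hdV0 μ hμ a₁ a₂ χ v x hx
  obtain ⟨E₁⟩ := hLR L e₁ (Equiv.prodUnique (Fin 3) (Fin 1)) dV hdV hdV0 μ hμ a₁ χ v
  obtain ⟨E⟩ := hLTpu L dV hdV hdV0 μ hμ a₁ a₂ χ v x hx
  obtain ⟨E₂⟩ := hLR L (Equiv.prodUnique (Fin 3) (Fin 1)) e₁ dV hdV hdV0 μ hμ a₂ χ v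
  exact ⟨E₁.trans (E.trans E₂)⟩

/-- **THE ONE CONCLUDER of the derived node LT** over the registered stubs LR + LTpu (§2b). -/
theorem stub_LT_localTypeTransport : StubLTLocalTypeTransport :=
  lt_of_LR_LTpu stub_LR_localReindex stub_LTpu_prodUnique

-- heartbeats: the CE_R ∕ PK telescopes (as F0P2-p01 (g3)'s `stubCE_of_localThetaTypes`, same budget)
set_option synthInstance.maxHeartbeats 400000 in
set_option maxHeartbeats 8000000 in
/-- **CE_R from the rung-2 road**: PK gives `(μ, χ, (ε_v)_v, a₀)` with `σ_v` `X_v(μ,ε_v,χ) ∘ κ_v⁻¹`-isotypic; GL a GLOBAL `a` with the class of `ε_v` at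
every `v`; LW a norm witness at each `v`; LT the equivalence `X_v(μ,ε_v,χ) ≃ X_v(μ,a,χ)`; isotypy is transported along it (pulled back by `κ_v⁻¹`).
[cite: Rogawski1990, Thm 13.3.6 (c)] [cite: GelbartRogawski1991, Thm 5.1.1, Lem 5.1.2] [cite: Liu2021, Def 4.12, App. D Lem D.1 (3)] [cite: Omeara1963, §71 Thm. 71:19] -/
theorem coreCER_of_PK_GL_LW_LT (hPK : StubPKLocalThetaClasses) (hGL : StubGLGlobalLine) (hLW : StubLWLocalWitness)
    (hLT : StubLTLocalTypeTransport) : CoreCER := by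
  intro L _ _ _ ι H T hT hdef h2 n' e₁ dV hdV hdV0 g hg ιV hιV μA _ W _ _ σ hirr hsm hadm P hP hfin
  obtain ⟨μ, hμ, hw, χ, ε, a₀, hcof, hloc⟩ :=
    hPK L ι H T hT hdef h2 e₁ dV hdV hdV0 g hg ιV hιV μA W σ hirr hsm hadm P hP hfin
  obtain ⟨a, ha⟩ := hGL L ε a₀ hcof
  refine ⟨μ, hμ, hw, a, χ, fun v => ?_⟩
  obtain ⟨x, hx⟩ := hLW L (ε v) a v (ha v).symm
  obtain ⟨E⟩ := hLT L e₁ dV hdV hdV0 μ hμ (ε v) a χ v x hx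
  exact (isotypicComponent_comp_congr_of_equiv E _ _).symm.trans (hloc v)

/-- **THE HEAD — the registered engine letter CE of the (C)-line from the rung-2 road**: `PK → GL → LW → LT → CER → CE`, concluding
`CETarget` = the registered CE pasted verbatim (δ-equal to `F0P2CohFinComponentIsThetaC.StubCELocalTypesTheta`).  The registrar's fold of the (C)-line: `theorem stub_CE_localTypesTheta :
StubCELocalTypesTheta := F0P2CELocalToGlobal.stubCE_of_rung2_stubs` (its `sorry`s then = {PK, GL, LW, LT, CER} of THIS file, shrinking as they ★).
[cite: Rogawski1990, Thm 13.3.6 (c)] [cite: GelbartRogawski1991, Thm 5.1.1, Lem 5.1.2] [cite: Liu2021, Def 4.11, Rem 4.14, App. D] -/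
theorem stubCE_of_rung2 (hPK : StubPKLocalThetaClasses) (hGL : StubGLGlobalLine) (hLW : StubLWLocalWitness)
    (hLT : StubLTLocalTypeTransport) (hCER : StubCERCoreToCE) : CERecorded :=
  hCER (coreCER_of_PK_GL_LW_LT hPK hGL hLW hLT)

/-- **THE ONE CONCLUDER BY NAME** — the head over the registered stubs (registrar fold target; §2b). [cite: Rogawski1990, Thm 13.3.6 (c)] [cite: Liu2021, Def 4.11, App. D] -/
theorem stubCE_of_rung2_stubs : CETarget :=
  stubCE_of_rung2 stub_PK_localThetaClasses stub_GL_globalLine stub_LW_localWitness stub_LT_localTypeTransport stub_CER_coreToCE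

set_option synthInstance.maxHeartbeats 400000 in
set_option maxHeartbeats 8000000 in
/-- **converse bookkeeping — PK ⇐ CE_R** (take `ε_v := a`, `a₀ := a`): the engine letter is NOT stronger than the node it replaces.
[cite: Rogawski1990, Thm 13.3.6 (c)] [cite: Liu2021, Def 4.12] -/
theorem stubPK_of_coreCER (hR : CoreCER) : PKRecorded := by
  show StubPKLocalThetaClasses
  intro L _ _ _ ι H T hT hdef h2 n' e₁ dV hdV hdV0 g hg ιV hιV μA _ W _ _ σ hirr hsm hadm P hP hfin
  obtain ⟨μ, hμ, hw, a, χ, hloc⟩ := hR L ι H T hT hdef h2 e₁ dV hdV hdV0 g hg ιV hιV μA W σ hirr hsm hadm P hP hfin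
  exact ⟨μ, hμ, hw, χ, fun _ => a, a, Filter.Eventually.of_forall fun _ => rfl, hloc⟩

end Summit.HodgeConjecture.HodgeConjecture.Cruxes.H413.F0P2CELocalToGlobal

end
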